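import Summits.BirchSwinnertonDyer.BirchSwinnertonDyer.Theorems.GenusKolyvaginAtTwoTorsionCellSELLaplacianParity
import HarnessLib

/-!
# SEL (iso-class Selmer pair law), C1-A: `𝔽₂`-algebra of the BORDERED Laplacian `B = Ĝ + diag([−p₀/qⱼ])`

Crux R″ `RankOneTwoTorsionResidualAtTwo` (stmt-27478), LINE 49 «full_vertex», SUPPORT stub SEL
`IsoClassSelmerPairLawAtTwo`, the `C₁` conjunct `#Sel⁽²⁾(C₁) = 8 · #ker Φ₃(B)` (LEAD memo
`Cruxes/…/Lines/torsion_cell_full_vertex_SEL_C1_road_g36.md`, §4 bricks (A1)–(A4) and the K-lemma).  Pure linear algebra over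
`𝔽₂` of the Defs' `borderedLaplacian Q p₀` (`B`) and `phi3` (`Φ₃`), for a set `Q` of primes `≡ 3 (mod 4)` of even size and ANY
border `π j = legendreBit (−p₀) j` (no hypothesis on `p₀`):

* entries: off the diagonal `B` is the tournament `Ĝ` (`B j i + B i j = 1`), on it `Ĝ j j + π j`;
* `borderedLaplacian_mulVec_const` (`B𝟙 = π`), `sum_mulVec_borderedLaplacian_eq` (`𝟙ᵀB = 𝟙ᵀ + πᵀ`),
  `sum_mul_borderedLaplacian_col` (`yᵀB = (By)ᵀ + yᵀ + |y|𝟙ᵀ`, i.e. `Bᵀ = B + I + J`);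
* `sum_phi3_mulVec_eq` (`𝟙ᵀΦ₃(B)χ = |χ| + πᵀBχ`), `sum_mul_phi3_col` (`Φ₃(B)ᵀy = Φ₃(B)y + |y|π + (πᵀy)𝟙`),
  `dotProduct_self_phi3_mulVec` (the quadratic form `χᵀΦ₃(B)χ = |χ| + (πᵀχ)(|χ| + 1)`);
* **K-LEMMA** `sum_eq_zero_of_phi3_mulVec_eq_zero` / `…_of_phi3_transpose`: `𝟙ᵀ` and `πᵀ` vanish on `ker Φ₃(B)` and on
  `ker Φ₃(B)ᵀ` (so `dim ker Φ₃(B)` is even and `𝟙, π ∈ im Φ₃(B)`; the latter is part C1-B).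

Everything is proved; no LINE 49 statement is restated; BSD is not advanced by this file alone.

## References

* [HeathBrown1994SelmerCongruentII] D. R. Heath-Brown, Invent. Math. 118 (1994), §2 (Laplacian/tournament linear algebra).
* [Kane2013SelmerTwists] D. M. Kane, Algebra Number Theory 7 (2013), §2.
-/

namespace Summit.BirchSwinnertonDyer.BirchSwinnertonDyer.Theorems.GenusKolyvaginAtTwo.FullVertex

open Matrix
open Summit.BirchSwinnertonDyer.BirchSwinnertonDyer.Theorems.GenusKolyvaginAtTwo.TorsionCellSEL

variable (Q : Finset ℕ) (p₀ : ℕ)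

/-! ## `𝔽₂` scalar facts -/

/-- `𝔽₂`: `x + y = 1 ⇒ y = x + 1`. [folklore] -/
private theorem zmod2_eq_add_one_of_add_eq_one (x y : ZMod 2) (h : x + y = 1) : y = x + 1 := by
  revert x y; decide

/-- `𝔽₂`: `x² = x`. [folklore] -/
private theorem zmod2_mul_self (x : ZMod 2) : x * x = x := by revert x; decide

/-- `𝔽₂`: `a + p(a+1) = 0 ⇒ a = 0` (the K-lemma's scalar step). [folklore] -/
private theorem zmod2_klemma (a p : ZMod 2) (h : a + p * (a + 1) = 0) : a = 0 := by
  revert a p; decide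

/-- `𝔽₂`: `2 = 0`. [folklore] -/
private theorem zmod2_two : (2 : ZMod 2) = 0 := by decide

/-- `𝔽₂`: `3 = 1`. [folklore] -/
private theorem zmod2_three : (3 : ZMod 2) = 1 := by decide

/-! ## Entries of `B` -/

/-- Off the diagonal the bordered Laplacian is the Rédei–Laplacian: `B j i = [−qᵢ/qⱼ]`.
[cite: HeathBrown1994SelmerCongruentII, §2] -/
theorem borderedLaplacian_apply_of_ne {i j : Q} (hij : i ≠ j) :
    borderedLaplacian Q p₀ j i = legendreBit (-((i : ℕ) : ℤ)) j := by
  unfold borderedLaplacian redeiLaplacian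
  rw [Matrix.add_apply, Matrix.diagonal_apply_ne _ (Ne.symm hij), add_zero, if_neg hij]

/-- On the diagonal: `B j j = Ĝ j j + [−p₀/qⱼ]`. [cite: HeathBrown1994SelmerCongruentII, §2] -/
theorem borderedLaplacian_apply_same (j : Q) :
    borderedLaplacian Q p₀ j j = redeiLaplacian Q j j + legendreBit (-(p₀ : ℤ)) (j : ℕ) := by
  unfold borderedLaplacian
  rw [Matrix.add_apply, Matrix.diagonal_apply_eq]

section Tournament

variable (hQ : ∀ q ∈ Q, q.Prime) (hQ4 : ∀ q ∈ Q, q % 4 = 3)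
include hQ hQ4

/-- **Tournament**: `B j i + B i j = 1` for `i ≠ j` (reciprocity between primes `≡ 3 (mod 4)`).
[cite: HeathBrown1994SelmerCongruentII, §2] -/
theorem borderedLaplacian_add_transpose_of_ne {i j : Q} (hij : i ≠ j) :
    borderedLaplacian Q p₀ j i + borderedLaplacian Q p₀ i j = 1 := by
  have hne : (i : ℕ) ≠ (j : ℕ) := fun h => hij (Subtype.ext h)
  rw [borderedLaplacian_apply_of_ne Q p₀ hij, borderedLaplacian_apply_of_ne Q p₀ (Ne.symm hij), legendreBit_eq_ite,
    legendreBit_eq_ite]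
  exact jacobiBit_add_jacobiBit_eq_one (hQ i i.2) (hQ j j.2) hne (hQ4 i i.2) (hQ4 j j.2)

/-- `B i j = B j i + 1` for `i ≠ j`. [cite: HeathBrown1994SelmerCongruentII, §2] -/
theorem borderedLaplacian_transpose_apply_of_ne {i j : Q} (hij : i ≠ j) :
    borderedLaplacian Q p₀ i j = borderedLaplacian Q p₀ j i + 1 :=
  zmod2_eq_add_one_of_add_eq_one _ _ (borderedLaplacian_add_transpose_of_ne Q p₀ hQ hQ4 hij)

end Tournament

/-! ## `B𝟙 = π`, `𝟙ᵀB = 𝟙ᵀ + πᵀ`, `Bᵀ = B + I + J` -/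

/-- **`B(c𝟙) = cπ`** (`Ĝ𝟙 = 0`). [cite: HeathBrown1994SelmerCongruentII, §2] -/
theorem borderedLaplacian_mulVec_const (c : ZMod 2) :
    borderedLaplacian Q p₀ *ᵥ (fun _ => c) = fun j : Q => c * legendreBit (-(p₀ : ℤ)) (j : ℕ) := by
  unfold borderedLaplacian
  rw [add_mulVec, redeiLaplacian_mulVec_const, zero_add]
  ext j
  rw [mulVec_diagonal, mul_comm]

/-- Row sums: `Σ_i B j i = π j`. [cite: HeathBrown1994SelmerCongruentII, §2] -/
theorem sum_borderedLaplacian_row (j : Q) :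
    ∑ i : Q, borderedLaplacian Q p₀ j i = legendreBit (-(p₀ : ℤ)) (j : ℕ) := by
  have h := congr_fun (borderedLaplacian_mulVec_const Q p₀ 1) j
  simp only [mulVec, dotProduct, mul_one, one_mul] at h
  exact h

section Sums

variable (hQ : ∀ q ∈ Q, q.Prime) (hQ4 : ∀ q ∈ Q, q % 4 = 3) (hk : Even Q.card)
include hQ hQ4

/-- **`yᵀB = (By)ᵀ + yᵀ + |y|𝟙ᵀ`** (i.e. `Bᵀ = B + I + J`): `Σ_i y i · B i j = (By) j + y j + Σ_i y i`.
[cite: HeathBrown1994SelmerCongruentII, §2] -/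
theorem sum_mul_borderedLaplacian_col (y : Q → ZMod 2) (j : Q) :
    ∑ i : Q, y i * borderedLaplacian Q p₀ i j = (borderedLaplacian Q p₀ *ᵥ y) j + y j + ∑ i : Q, y i := by
  classical
  rw [mulVec, dotProduct]
  have key : ∀ i : Q, y i * borderedLaplacian Q p₀ i j =
      borderedLaplacian Q p₀ j i * y i + (y i + (if i = j then y i else 0)) := by
    intro i
    by_cases hij : i = j
    · subst hij; rw [if_pos rfl, CharTwo.add_self_eq_zero, add_zero, mul_comm]
    · rw [if_neg hij, add_zero, borderedLaplacian_transpose_apply_of_ne Q p₀ hQ hQ4 hij]; ring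
  rw [Finset.sum_congr rfl fun i _ => key i, Finset.sum_add_distrib, Finset.sum_add_distrib,
    Finset.sum_ite_eq' Finset.univ j y, if_pos (Finset.mem_univ j)]
  ring

include hk

/-- **`𝟙ᵀB = 𝟙ᵀ + πᵀ`**: `Σ_j (Bχ) j = Σ_j χ j + Σ_j π j · χ j` (columns of the tournament sum to `1 + g`, `#Q` even).
[cite: HeathBrown1994SelmerCongruentII, §2] -/
theorem sum_mulVec_borderedLaplacian_eq (χ : Q → ZMod 2) :
    ∑ j : Q, (borderedLaplacian Q p₀ *ᵥ χ) j =
      ∑ j : Q, χ j + ∑ j : Q, legendreBit (-(p₀ : ℤ)) (j : ℕ) * χ j := by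
  unfold borderedLaplacian
  rw [add_mulVec]
  simp only [Pi.add_apply, Finset.sum_add_distrib, mulVec_diagonal]
  rw [sum_mulVec_redeiLaplacian_eq Q hQ hQ4 hk]

/-! ## `Φ₃(B)` -/

omit hQ hQ4 hk in
/-- `Φ₃(B)χ = B(Bχ) + Bχ + χ`. [cite: HeathBrown1994SelmerCongruentII, §2] -/
theorem phi3_mulVec (χ : Q → ZMod 2) :
    phi3 (borderedLaplacian Q p₀) *ᵥ χ =
      borderedLaplacian Q p₀ *ᵥ (borderedLaplacian Q p₀ *ᵥ χ) + borderedLaplacian Q p₀ *ᵥ χ + χ := by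
  unfold phi3
  rw [add_mulVec, add_mulVec, one_mulVec, ← mulVec_mulVec]

omit hQ hQ4 hk in
/-- `Φ₃(B)` commutes with `B`: `Φ₃(B)(Bχ) = B(Φ₃(B)χ)`. [cite: HeathBrown1994SelmerCongruentII, §2] -/
theorem phi3_mulVec_mulVec (χ : Q → ZMod 2) :
    phi3 (borderedLaplacian Q p₀) *ᵥ (borderedLaplacian Q p₀ *ᵥ χ) =
      borderedLaplacian Q p₀ *ᵥ (phi3 (borderedLaplacian Q p₀) *ᵥ χ) := by
  rw [phi3_mulVec, phi3_mulVec, mulVec_add, mulVec_add]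

/-- **(A3) `𝟙ᵀΦ₃(B) = 𝟙ᵀ + πᵀB`**: `Σ_j (Φ₃(B)χ) j = Σ_j χ j + Σ_j π j · (Bχ) j`.
[cite: HeathBrown1994SelmerCongruentII, §2] -/
theorem sum_phi3_mulVec_eq (χ : Q → ZMod 2) :
    ∑ j : Q, (phi3 (borderedLaplacian Q p₀) *ᵥ χ) j =
      ∑ j : Q, χ j + ∑ j : Q, legendreBit (-(p₀ : ℤ)) (j : ℕ) * (borderedLaplacian Q p₀ *ᵥ χ) j := by
  rw [phi3_mulVec]
  simp only [Pi.add_apply, Finset.sum_add_distrib]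
  rw [sum_mulVec_borderedLaplacian_eq Q p₀ hQ hQ4 hk (borderedLaplacian Q p₀ *ᵥ χ),
    sum_mulVec_borderedLaplacian_eq Q p₀ hQ hQ4 hk χ]
  ring_nf
  simp only [zmod2_two, zmod2_three, mul_zero, add_zero, mul_one]

/-- **`Φ₃(B)ᵀ = Φ₃(B) + π𝟙ᵀ + 𝟙πᵀ`** (column form): `Σ_i y i · Φ₃(B) i j = (Φ₃(B)y) j + |y|·π j + Σ_i π i · y i`.
[cite: HeathBrown1994SelmerCongruentII, §2] -/
theorem sum_mul_phi3_col (y : Q → ZMod 2) (j : Q) :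
    ∑ i : Q, y i * phi3 (borderedLaplacian Q p₀) i j =
      (phi3 (borderedLaplacian Q p₀) *ᵥ y) j + (∑ i : Q, y i) * legendreBit (-(p₀ : ℤ)) (j : ℕ) +
        ∑ i : Q, legendreBit (-(p₀ : ℤ)) (i : ℕ) * y i := by
  -- abbreviations
  set B := borderedLaplacian Q p₀ with hB
  have hT : ∀ (v : Q → ZMod 2) (l : Q), ∑ i : Q, v i * B i l = (B *ᵥ v) l + v l + ∑ i : Q, v i :=
    fun v l => sum_mul_borderedLaplacian_col Q p₀ hQ hQ4 v l
  -- entries of `Φ₃(B)`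
  have hΦ : ∀ i : Q, phi3 B i j = (∑ l : Q, B i l * B l j) + B i j + (if i = j then 1 else 0) := by
    intro i; unfold phi3; rw [Matrix.add_apply, Matrix.add_apply, Matrix.mul_apply, Matrix.one_apply]
  simp only [hΦ, mul_add, Finset.sum_add_distrib]
  -- the three pieces
  have h1 : ∑ i : Q, y i * (∑ l : Q, B i l * B l j) = ∑ l : Q, (∑ i : Q, y i * B i l) * B l j := by
    simp only [Finset.mul_sum, Finset.sum_mul]
    rw [Finset.sum_comm]
    exact Finset.sum_congr rfl fun l _ => Finset.sum_congr rfl fun i _ => by ring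
  have h1' : ∑ l : Q, (∑ i : Q, y i * B i l) * B l j =
      ∑ l : Q, ((B *ᵥ y) l + y l + ∑ i : Q, y i) * B l j :=
    Finset.sum_congr rfl fun l _ => by rw [hT y l]
  -- `u := By + y + |y|𝟙`
  set u : Q → ZMod 2 := fun l => (B *ᵥ y) l + y l + ∑ i : Q, y i with hu
  have h1'' : ∑ l : Q, ((B *ᵥ y) l + y l + ∑ i : Q, y i) * B l j = (B *ᵥ u) j + u j + ∑ l : Q, u l := hT u j
  have hBu : (B *ᵥ u) j = (B *ᵥ (B *ᵥ y)) j + (B *ᵥ y) j + (∑ i : Q, y i) * legendreBit (-(p₀ : ℤ)) (j : ℕ) := by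
    have : u = B *ᵥ y + y + fun _ => ∑ i : Q, y i := by ext l; simp [hu]
    rw [this, mulVec_add, mulVec_add, hB, borderedLaplacian_mulVec_const]
    rfl
  have hsu : ∑ l : Q, u l = ∑ i : Q, legendreBit (-(p₀ : ℤ)) (i : ℕ) * y i := by
    have e1 : ∑ l : Q, u l = ∑ l : Q, (B *ᵥ y) l + ∑ l : Q, y l + ∑ _l : Q, (∑ i : Q, y i) := by
      simp only [hu, Finset.sum_add_distrib]
    have e2 : ∑ _l : Q, (∑ i : Q, y i) = 0 := by
      rw [Finset.sum_const, Finset.card_univ, Fintype.card_coe, nsmul_eq_mul]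
      obtain ⟨r, hr⟩ := hk
      rw [hr, ← two_mul, Nat.cast_mul, Nat.cast_two, zmod2_two, zero_mul, zero_mul]
    rw [e1, e2, add_zero, hB, sum_mulVec_borderedLaplacian_eq Q p₀ hQ hQ4 hk y, add_comm (∑ l : Q, y l) _, add_assoc,
      CharTwo.add_self_eq_zero, add_zero]
  have h2 : ∑ i : Q, y i * B i j = (B *ᵥ y) j + y j + ∑ i : Q, y i := hT y j
  have h3 : ∑ i : Q, y i * (if i = j then (1 : ZMod 2) else 0) = y j := by
    simp [Finset.sum_ite_eq']
  rw [h1, h1', h1'', hBu, hsu, h2, h3, phi3_mulVec, ← hB]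
  simp only [Pi.add_apply, hu]
  linear_combination ((B *ᵥ y) j + y j + ∑ i : Q, y i) * zmod2_two

/-- **(A4) the quadratic form of `Φ₃(B)`**: `χᵀΦ₃(B)χ = |χ| + (πᵀχ)(|χ| + 1)`.
[cite: HeathBrown1994SelmerCongruentII, §2] -/
theorem dotProduct_self_phi3_mulVec (χ : Q → ZMod 2) :
    ∑ j : Q, χ j * (phi3 (borderedLaplacian Q p₀) *ᵥ χ) j =
      ∑ j : Q, χ j + (∑ j : Q, legendreBit (-(p₀ : ℤ)) (j : ℕ) * χ j) * (∑ j : Q, χ j + 1) := by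
  set B := borderedLaplacian Q p₀ with hB
  set u := B *ᵥ χ with hu
  have hT : ∀ l : Q, ∑ i : Q, χ i * B i l = u l + χ l + ∑ i : Q, χ i :=
    fun l => sum_mul_borderedLaplacian_col Q p₀ hQ hQ4 χ l
  rw [phi3_mulVec, ← hu]
  simp only [Pi.add_apply, mul_add, Finset.sum_add_distrib]
  -- `χ·(Bu) = Σ_l (Σ_i χ i B i l) u l`
  have h1 : ∑ j : Q, χ j * (B *ᵥ u) j = ∑ l : Q, (u l + χ l + ∑ i : Q, χ i) * u l := by
    simp only [mulVec, dotProduct, Finset.mul_sum]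
    rw [Finset.sum_comm]
    refine Finset.sum_congr rfl fun l _ => ?_
    rw [← hT l, Finset.sum_mul]
    exact Finset.sum_congr rfl fun i _ => by ring
  have hsu : ∑ l : Q, u l = ∑ j : Q, χ j + ∑ j : Q, legendreBit (-(p₀ : ℤ)) (j : ℕ) * χ j := by
    rw [hu, hB]; exact sum_mulVec_borderedLaplacian_eq Q p₀ hQ hQ4 hk χ
  have huu : ∀ l : Q, u l * u l = u l := fun l => zmod2_mul_self _
  have hχχ : ∀ l : Q, χ l * χ l = χ l := fun l => zmod2_mul_self _
  rw [h1]
  simp only [add_mul, Finset.sum_add_distrib, huu, hχχ, ← Finset.mul_sum]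
  rw [hsu]
  have hcomm : ∑ j : Q, χ j * u j = ∑ j : Q, u j * χ j := Finset.sum_congr rfl fun j _ => mul_comm _ _
  rw [hcomm]
  set a := ∑ j : Q, χ j
  set p := ∑ j : Q, legendreBit (-(p₀ : ℤ)) (j : ℕ) * χ j
  set c := ∑ j : Q, u j * χ j
  clear_value a p c u
  clear hT h1 hsu hcomm huu hχχ hu hB
  revert a p c; decide

/-! ## The K-lemma: `𝟙ᵀ` and `πᵀ` vanish on `ker Φ₃(B)` and on `ker Φ₃(B)ᵀ` -/

/-- **K-LEMMA**: if `Φ₃(B)χ = 0` then `Σ χ = 0` and `Σ π·χ = 0`. [cite: HeathBrown1994SelmerCongruentII, §2] -/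
theorem sum_eq_zero_of_phi3_mulVec_eq_zero {χ : Q → ZMod 2} (h : phi3 (borderedLaplacian Q p₀) *ᵥ χ = 0) :
    ∑ j : Q, χ j = 0 ∧ ∑ j : Q, legendreBit (-(p₀ : ℤ)) (j : ℕ) * χ j = 0 := by
  set B := borderedLaplacian Q p₀ with hB
  -- `|χ| = 0` from the quadratic form
  have hq := dotProduct_self_phi3_mulVec Q p₀ hQ hQ4 hk χ
  rw [h] at hq
  simp only [Pi.zero_apply, mul_zero, Finset.sum_const_zero] at hq
  have ha : ∑ j : Q, χ j = 0 := zmod2_klemma _ _ hq.symm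
  refine ⟨ha, ?_⟩
  -- the same for `χ' := Bχ + χ ∈ ker`, and `B χ' = χ`
  set χ' : Q → ZMod 2 := B *ᵥ χ + χ with hχ'
  have hker' : phi3 B *ᵥ χ' = 0 := by
    rw [hχ', mulVec_add, hB, phi3_mulVec_mulVec, ← hB, h, mulVec_zero, zero_add]
  have hBχ' : B *ᵥ χ' = χ := by
    have e := phi3_mulVec Q p₀ χ
    rw [← hB, h] at e
    rw [hχ', mulVec_add]
    -- from `0 = B(Bχ) + Bχ + χ`
    have : B *ᵥ (B *ᵥ χ) + B *ᵥ χ = -χ := by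
      rw [eq_neg_iff_add_eq_zero, ← e]
    rw [this]; ext j; simp
  -- (A3) for `χ'`
  have h3 := sum_phi3_mulVec_eq Q p₀ hQ hQ4 hk χ'
  rw [hker', hBχ'] at h3
  simp only [Pi.zero_apply, Finset.sum_const_zero] at h3
  -- `|χ'| = 0` by the first part applied to `χ'`
  have hq' := dotProduct_self_phi3_mulVec Q p₀ hQ hQ4 hk χ'
  rw [hker'] at hq'
  simp only [Pi.zero_apply, mul_zero, Finset.sum_const_zero] at hq'
  have ha' : ∑ j : Q, χ' j = 0 := zmod2_klemma _ _ hq'.symm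
  rw [ha', zero_add] at h3
  exact h3.symm

/-- **K-LEMMA, transposed**: if `yᵀΦ₃(B) = 0` then `Σ y = 0` and `Σ π·y = 0` (hence `𝟙, π ⊥ ker Φ₃(B)ᵀ`).
[cite: HeathBrown1994SelmerCongruentII, §2] -/
theorem sum_eq_zero_of_phi3_transpose {y : Q → ZMod 2}
    (h : ∀ j : Q, ∑ i : Q, y i * phi3 (borderedLaplacian Q p₀) i j = 0) :
    ∑ j : Q, y j = 0 ∧ ∑ j : Q, legendreBit (-(p₀ : ℤ)) (j : ℕ) * y j = 0 := by
  set a := ∑ j : Q, y j with hadef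
  set c := ∑ j : Q, legendreBit (-(p₀ : ℤ)) (j : ℕ) * y j with hcdef
  -- `Φ y = |y| π + c 𝟙`
  have hΦy : ∀ j : Q, (phi3 (borderedLaplacian Q p₀) *ᵥ y) j = a * legendreBit (-(p₀ : ℤ)) (j : ℕ) + c := by
    intro j
    have e := sum_mul_phi3_col Q p₀ hQ hQ4 hk y j
    rw [h j] at e
    have : (phi3 (borderedLaplacian Q p₀) *ᵥ y) j = -(a * legendreBit (-(p₀ : ℤ)) (j : ℕ) + c) := by
      rw [eq_neg_iff_add_eq_zero, ← add_assoc, ← e]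
    rw [this, ZModModule.neg_eq_self]
  -- quadratic form: `yᵀΦy = a·c + c·a = 0`, and `= a + c(a+1)` ⇒ `a = 0`
  have hq := dotProduct_self_phi3_mulVec Q p₀ hQ hQ4 hk y
  have hlhs : ∑ j : Q, y j * (phi3 (borderedLaplacian Q p₀) *ᵥ y) j = 0 := by
    simp only [hΦy, mul_add, Finset.sum_add_distrib, ← Finset.sum_mul]
    rw [← hadef, show ∑ j : Q, y j * (a * legendreBit (-(p₀ : ℤ)) (j : ℕ)) = a * c by
      rw [hcdef, Finset.mul_sum]; exact Finset.sum_congr rfl fun j _ => by ring]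
    ring_nf
    simp only [zmod2_two, mul_zero]
  rw [hlhs, ← hadef, ← hcdef] at hq
  have ha : a = 0 := zmod2_klemma _ _ hq.symm
  refine ⟨ha, ?_⟩
  -- now `Φy = c𝟙`
  have hΦy' : phi3 (borderedLaplacian Q p₀) *ᵥ y = fun _ => c := by ext j; rw [hΦy j, ha, zero_mul, zero_add]
  -- `|By| = a + c = c`
  have hsBy : ∑ j : Q, (borderedLaplacian Q p₀ *ᵥ y) j = c := by
    rw [sum_mulVec_borderedLaplacian_eq Q p₀ hQ hQ4 hk y, ← hadef, ← hcdef, ha, zero_add]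
  -- `πᵀ(By) = 0` from (A3): `Σ (Φy) = |y| + πᵀBy` and `Σ (Φy) = k c = 0`
  have hπBy : ∑ j : Q, legendreBit (-(p₀ : ℤ)) (j : ℕ) * (borderedLaplacian Q p₀ *ᵥ y) j = 0 := by
    have h3 := sum_phi3_mulVec_eq Q p₀ hQ hQ4 hk y
    rw [hΦy', ← hadef, ha, zero_add, Finset.sum_const, Finset.card_univ, Fintype.card_coe, nsmul_eq_mul] at h3
    have hkc : (Q.card : ZMod 2) * c = 0 := by
      obtain ⟨r, hr⟩ := hk
      rw [hr, ← two_mul, Nat.cast_mul, Nat.cast_two, zmod2_two, zero_mul, zero_mul]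
    rw [hkc] at h3
    exact h3.symm
  -- the quadratic form at `By`: left side `c · πᵀBy = 0`, right side `|By| + (πᵀBy)(|By|+1) = c`
  have hq' := dotProduct_self_phi3_mulVec Q p₀ hQ hQ4 hk (borderedLaplacian Q p₀ *ᵥ y)
  rw [phi3_mulVec_mulVec, hΦy', borderedLaplacian_mulVec_const, hsBy, hπBy, zero_mul, add_zero] at hq'
  have hl : ∑ j : Q, (borderedLaplacian Q p₀ *ᵥ y) j * (fun j : Q => c * legendreBit (-(p₀ : ℤ)) (j : ℕ)) j =
      c * ∑ j : Q, legendreBit (-(p₀ : ℤ)) (j : ℕ) * (borderedLaplacian Q p₀ *ᵥ y) j := by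
    rw [Finset.mul_sum]; exact Finset.sum_congr rfl fun j _ => by simp only []; ring
  rw [hl, hπBy, mul_zero] at hq'
  exact hq'.symm

end Sums

end Summit.BirchSwinnertonDyer.BirchSwinnertonDyer.Theorems.GenusKolyvaginAtTwo.FullVertex
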